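import Summits.BirchSwinnertonDyer.BirchSwinnertonDyer.Theses.GenusKolyvaginAtTwo
import Literature.NumberTheory.EllipticCurves.BSDSelmerCMPConverseRankOneProofs
import Literature.NumberTheory.EllipticCurves.BSDRankZeroDensityProofs

/-!
# Crux `MinimalTwinBSDTwo` (stmt-BirchSwinnertonDyer-22985), line `twin-unit` — reduction skeleton v1

Lead prover seat bsd-line-gk2-p1 (g0, 2026-08-27). Route `GenusKolyvaginAtTwo` (DRAFT rev 2), crux #6 (rank 6):
`BSD₂` for non-CM `E/ℚ` of analytic rank `1` with `#Sel₂(E) = 2` (the `2`-Selmer-minimal rank-`1` twins the supply crux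
`GenusPrimitiveSupplyAtTwo` produces). Miller's `BSD(E,2)` = (`rank = r_an`) ∧ (`Ш[2^∞]` finite) ∧
(`ord₂ #Ш_an = ord₂ #Ш[2^∞]`).

THE CUT. On the crux's hypotheses the `Ш`-side is FREE: `#Sel₂(E) = 2^{rank}·#E(ℚ)[2]·#Ш[2]` (Silverman AEC X.4.2, tree
`natCard_selmerGroup_eq`) with `rank = 1` forces `E(ℚ)[2] = 0` and `Ш[2] = 0`, hence `Ш(E)[2^∞] = 0` (tree
`primaryComponent_sha_eq_bot_of_card_selmerGroup_eq`, Burungale–Tian Cor. 1.4's last step at `p = 2`). So the crux is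
EXACTLY «`rank E(ℚ) = 1`» (Gross–Zagier–Kolyvagin) ∧ «`#Ш_an(E)` is a rational `2`-adic UNIT», i.e.
`ord₂( L'(E,1) / (Ω_E · Reg_E) ) = ord₂(∏ c_ℓ) − 2·ord₂(#E(ℚ)_tors) = ord₂(∏ c_ℓ)` (torsion odd as `E(ℚ)[2] = 0`).
Two registered stubs:
* **R** `stub_rankOne_GZK` — Gross–Zagier–Kolyvagin at analytic rank one: `rank E(ℚ) = 1` and `Ш(E)` finite. IN PRINT
  (Gross–Zagier 1986 + Kolyvagin 1990; tree named fact `rank_eq_analyticRank_of_analyticRank_le_one`); closed modulo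
  that fact (helper `stub_rankOne_GZK_of_published`, this seat).
* **U2** `stub_shaAn_twoAdicUnit` — THE HEART: for non-CM `E` with `r_an = 1` and `#Sel₂(E) = 2`, `#Ш_an(E) ∈ ℚ` with
  `ord₂ = 0`: the `2`-part of the Gross–Zagier formula in rank one («why it might fail» of the item: Manin-constant and
  real-component `2`-powers not controlled in print). OPEN for non-CM `E` (CM/congruent-number families: Tian 2014,
  Coates–Li–Tian–Zhai 2015, Cai–Li–Zhai 2020). Route's foreseen derivation: Kolyvagin EXACTNESS over the twin's own
  Heegner field at `M₀ = 0` (crux `KolyvaginExactAtTwo`) + `2`-primitivity of `y_K` + `2`-adic Gross–Zagier bookkeeping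
  (crux `ExactDescentAtTwo`-type) — i.e. U2 is where this line meets the other two cruxes.
GLUE PROVED HERE: `Ш(E)[2^∞] = ⊥` from `#Sel₂ = 2` and `rank = 1`; the assembly of Miller's three clauses.
`MinimalTwinBSDTwo_of` concludes the crux BY NAME; sorries only in `stub_*`. BSD is not proved by any of this.
-/

set_option linter.dupNamespace false

noncomputable section

open scoped Classical

namespace Summit.BirchSwinnertonDyer.BirchSwinnertonDyer.Cruxes.MinimalTwinBSDTwo.TwinUnit

open WeierstrassCurve Literature.NumberTheory.EllipticCurves

/-! ## §1 The two stubs -/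

/-- STUB R — GROSS–ZAGIER–KOLYVAGIN AT ANALYTIC RANK ONE (Gross–Zagier 1986 Thm. I.6.3; Kolyvagin 1990 Thm. A; Darmon
2004 Thm. 3.22): a (non-CM, `2`-Selmer-minimal — idle binders kept for the cut) `E/ℚ` of analytic rank `1` has
`rank E(ℚ) = 1` and finite `Ш(E/ℚ)`. IN PRINT; the tree's named fact `rank_eq_analyticRank_of_analyticRank_le_one`
restricted to `r_an = 1`. [cite: GrossZagier1986, Thm. I.6.3] [cite: Darmon2004, Thm. 3.22] -/
theorem stub_rankOne_GZK :
  ∀ (W : WeierstrassCurve ℚ) [W.IsElliptic] [W.IsGloballyMinimal],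
    ¬ W.HasCM → W.analyticRank = 1 → Nat.card (W.selmerGroup 2) = 2 →
    W.mordellWeilRank = 1 ∧ Finite W.sha
    := by
  sorry

/-- STUB U2 — `#Ш_an` IS A `2`-ADIC UNIT ON THE MINIMAL RANK-ONE LOCUS (the heart; Miller 2011 Def. 1.1 (iii)–(iv) at
`p = 2` with `#Ш[2^∞] = 1`): for non-CM `E/ℚ` (globally minimal `W`) of analytic rank `1` with `#Sel₂(E) = 2`,
`#Ш_an(E) = L'(E,1)·#E(ℚ)_tors² / (Ω_E · ∏ c_ℓ · Reg_E)` is a rational number of `2`-adic valuation `0`. OPEN for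
non-CM `E` (the `2`-part of Gross–Zagier in rank one; Manin constant, real components `[E(ℝ):E(ℝ)⁰]`, the index
`[E(K):ℤ y_K]` at `2`). [cite: Miller2011LMS, Def. 1.1 (arXiv:1010.2431 p. 3)] [cite: GrossZagier1986, Thm. I.6.3 and V.2]
-/
theorem stub_shaAn_twoAdicUnit :
  ∀ (W : WeierstrassCurve ℚ) [W.IsElliptic] [W.IsGloballyMinimal],
    ¬ W.HasCM → W.analyticRank = 1 → Nat.card (W.selmerGroup 2) = 2 →
    ∃ q : ℚ, shaAn W = (q : ℂ) ∧ padicValRat 2 q = 0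
    := by
  sorry

/-! ## §2 Glue (proved) -/

/-- **`#Sel₂(E) = 2` and `rank E(ℚ) = 1` force `E(ℚ)[2] = 0` and `Ш(E/ℚ)[2^∞] = 0`** (Silverman AEC Thm. X.4.2:
`#Sel^{(2)} = 2^{rank}·#E(ℚ)[2]·#Ш[2]`, tree `natCard_selmerGroup_eq`; then
`primaryComponent_sha_eq_bot_of_card_selmerGroup_eq`). [cite: SilvermanAEC2009, Thm. X.4.2] -/
theorem primaryComponent_sha_two_eq_bot (W : WeierstrassCurve ℚ) [W.IsElliptic]
    (hSel : Nat.card (W.selmerGroup 2) = 2) (hrank : W.mordellWeilRank = 1) :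
    AddCommGroup.primaryComponent W.sha 2 = ⊥ := by
  haveI : Fact (Nat.Prime 2) := ⟨Nat.prime_two⟩
  have hSel' : Nat.card (W.selmerGroup ((2 : ℕ) : ℤ)) = (2 : ℕ) := by exact_mod_cast hSel
  have hcard := W.natCard_selmerGroup_eq (n := 2) two_ne_zero
  rw [hSel', hrank, pow_one, mul_assoc] at hcard
  -- `2 · 1 = 2 · (#E(ℚ)[2] · #Ш[2])`, so `#E(ℚ)[2] · #Ш[2] = 1` and `#E(ℚ)[2] = 1`
  have h1 := Nat.eq_of_mul_eq_mul_left (show 0 < 2 by norm_num) ((mul_one 2).trans hcard)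
  exact primaryComponent_sha_eq_bot_of_card_selmerGroup_eq W 2 hSel' hrank
    (Nat.eq_one_of_mul_eq_one_right h1.symm)

/-! ## §3 Composition -/

/-- COMPOSITION (v1): R gives `rank = 1 = r_an`; the glue gives `Ш[2^∞] = ⊥` (finite, of order `1`, `ord₂ = 0`); U2 gives
`#Ш_an ∈ ℚ` with `ord₂ = 0`; these are Miller's three clauses of `BSD(E,2)`. Concludes the route crux BY NAME;
sorry-free outside the two stubs. [cite: Miller2011LMS, Def. 1.1 (arXiv:1010.2431 p. 3)] -/
theorem MinimalTwinBSDTwo_of :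
    Summit.BirchSwinnertonDyer.BirchSwinnertonDyer.Theses.GenusKolyvaginAtTwo.MinimalTwinBSDTwo := by
  intro W _ _ hcm hr1 hSel
  obtain ⟨hrank, _hfin⟩ := stub_rankOne_GZK W hcm hr1 hSel
  obtain ⟨q, hq, hv⟩ := stub_shaAn_twoAdicUnit W hcm hr1 hSel
  have hbot := primaryComponent_sha_two_eq_bot W hSel hrank
  refine ⟨by rw [hrank, hr1], ?_, q, hq, ?_⟩
  · rw [hbot]; infer_instance
  · rw [hv, hbot, AddSubgroup.card_bot, padicValNat_one_right, Nat.cast_zero]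

end Summit.BirchSwinnertonDyer.BirchSwinnertonDyer.Cruxes.MinimalTwinBSDTwo.TwinUnit

end
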